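import Summits.BirchSwinnertonDyer.BirchSwinnertonDyer.Theorems.EisensteinPrimesBSDpOnCellCOfCitedFactsV18
import Summits.BirchSwinnertonDyer.BirchSwinnertonDyer.Theorems.EisensteinPrimesBSDpOnCellCTelescopeBranchUntwistedOfFrobenius
import HarnessLib

/-!
# [telescope v19 — successor LEAD cruxlead-19034 g6, 2026-08-30] CRUX 4 `BSDpOnCellC` FROM THE FROBENIUS-CURRENCY CITED FACT T-An-2ᶠ AND CRUX 3 — CONDITIONAL CLOSURE, SORRY-FREE (sibling of p769883 / p775405)
# Crux 4 `BSDpOnCellC` (stmt-BirchSwinnertonDyer-19034), line «telescope» v19 (`--supports`, helper; CONDITIONAL — closes nothing)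

WHAT: `bsdpOnCellC_of_citedFactsF (hPub) (hPre) (hGal) (hMazur) : …Theses.EisensteinPrimes.BSDpOnCellC` with `hPub`/`hPre`/`hMazur` the texts of v17–v19's `stub_publishedFacts`
(23 refereed named facts) / `stub_preprintFacts` (Keller–Yin 2024 ×4) / `stub_mazurMC_cellB` (crux 3) token for token, and `hGal` = the v19 assembled cite stub's fact T-An-2ᶠ
`Literature.NumberTheory.EllipticCurves.hida1986_castella2020_exists_frobeniusGaloisLattice_on_pNewBranchChart` (ideator bsd-idea-12 g43, p776194: Hida 1986 Thm. 2.1 (2.2b), and (2.2c) read through (2.1b) —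
the Frobenius CHARACTERISTIC POLYNOMIALS of the reductions at `X = 0` and at the member points, `X² − a_ℓ(E)X + ℓ` / `X² − ι_t(a_ℓ(g_t))X + ℓ^{k_t−1}`, `ℓ ∤ Np` — on Castella's analytic chart;
no equivalence of representations asserted). PROOF = ONE LINE: the v18 closure `EisensteinPrimesBSDpOnCellCOfCitedFactsV18.bsdpOnCellC_of_citedFactsH` (LEAD g5 p775405) with `hGal` transported
along the LANDED bridge `TelescopeBranchUntwistedOfFrobenius.untwistedGaloisLattice_of_frobeniusGaloisLattice : T-An-2ᶠ → T-An-2ᴴ` (width x2-p2 g24 p777078: the recognition theorem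
`FramedGaloisRep.nonempty_equiv_of_hasFrobCharpolyAt_of_finite_of_isIrreducible` fed by Ribet 1977 Thm. (2.3) on the members and by the Tate-frame brick of ideator g43 on the zero fibre — tree theorems).

HONEST FRAMING: CONDITIONAL result (the gate records it as such); it discharges none of its four hypotheses; closes no registered stub, no crux, no summit statement; BSD is proved
for no curve by this file. THEOREMS ONLY: no definition, no named fact, no instance, no `sorry`.
References (shape only): [cite: Hida1986, Thm. 2.1 (2.2b) (2.2c), §2 (2.1b)] [cite: Ribet1977, Thm. 2.3] [cite: KellerYin2024, Thm. 3.0.8, Thm. 2.2.2 (arXiv:2402.12781v2)] [cite: GreenbergVatsal2000, Thm. (1.3)]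
-/

set_option autoImplicit false
set_option linter.dupNamespace false

noncomputable section

open scoped Classical MatrixGroups ModularForm

open CongruenceSubgroup WeierstrassCurve NumberField IsDedekindDomain Field PowerSeries
  Literature.NumberTheory.EllipticCurves Literature.NumberTheory.EllipticCurves.GreenbergSelmer
  Literature.NumberTheory.EllipticCurves.ModularForms Literature.NumberTheory.QuadraticFields
  Literature.NumberTheory.EllipticCurves.Rank1Residual
  Literature.NumberTheory.EllipticCurves.Rank1Residual.Typed
  Literature.NumberTheory.EllipticCurves.KrizLi2019
  Literature.NumberTheory.EllipticCurves.GreenbergVatsal2000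
  Literature.NumberTheory.EllipticCurves.Wuthrich2014
  Literature.NumberTheory.EllipticCurves.SteinWuthrich2013
  Literature.NumberTheory.EllipticCurves.Castella2018Exceptional
  Literature.NumberTheory.GaloisRepresentations Literature.NumberTheory.GaloisCohomology
  Literature.NumberTheory.Automorphic
  Summit.BirchSwinnertonDyer.Rank1Residual.X11b.AcSelmer
  Summit.BirchSwinnertonDyer.Rank1Residual.X11b.Halves
  Summit.BirchSwinnertonDyer.Rank1Residual.X11b
  Summit.BirchSwinnertonDyer.Rank1Residual Summit.BirchSwinnertonDyer.Rank1Residual.X1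
  Summit.BirchSwinnertonDyer.Rank1Residual.X2
open Literature.NumberTheory.EllipticCurves.KellerYin2024 (curveLocalLambda)


open Literature.NumberTheory.EllipticCurves.BigGaloisRep


namespace Summit.BirchSwinnertonDyer.BirchSwinnertonDyer.Theorems.EisensteinPrimesBSDpOnCellCOfCitedFactsV19

open Literature.NumberTheory.EllipticCurves.CastellaGrossiLeeSkinner2022 Literature.NumberTheory.EllipticCurves.Castella2018
  Literature.NumberTheory.IwasawaTheory Literature.NumberTheory.IwasawaTheory.Greenberg2016
  Literature.NumberTheory.IwasawaTheory.Greenberg2006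
  Summit.BirchSwinnertonDyer.Rank1Residual.X1.KellerYinMuLambdaSplit
open Literature.NumberTheory.EllipticCurves.KellerYin2024
open Summit.BirchSwinnertonDyer.BirchSwinnertonDyer.Theorems

/-- **Crux 4 `BSDpOnCellC` from the Frobenius-currency cited fact T-An-2ᶠ, the other cited facts and crux 3 (telescope v19, conditional closure).** Hypotheses = the texts of v19's
four registered stubs token for token; proof = the v18 closure along the landed bridge T-An-2ᶠ → T-An-2ᴴ. CONDITIONAL: nothing here discharges the hypotheses.
[cite: Hida1986, Thm. 2.1 (2.2b) (2.2c), §2 (2.1b) (shape only)] [cite: Ribet1977, Thm. 2.3 (shape only)] [cite: KellerYin2024, Thm. 3.0.8 (shape only)] [cite: GreenbergVatsal2000, Thm. (1.3) (shape only)] -/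
theorem bsdpOnCellC_of_citedFactsF
    (hPub :
    ((((lambdaMu_multiplicative_of_gvPar ∧ thm16_charIdeal_dvd_multiplicative_of_reducible ∧
    thm61_splitMultiplicative ∧ thm61_nonsplitMultiplicative ∧
    (∀ (W : WeierstrassCurve ℚ) [W.IsElliptic] [W.IsGloballyMinimal] (p : ℕ) [Fact p.Prime],
      greenberg_stevens (W := W) (p := p)) ∧
    exists_isNewformOf ∧
    hsieh2014_exists_anticyclotomicPAdicLFunction ∧
    (∀ (N : ℕ) [NeZero N] (W : WeierstrassCurve ℚ) (K : Type) [Field K] [NumberField K],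
      gross_zagier N W K) ∧
    (∀ (N : ℕ) [NeZero N] (W : WeierstrassCurve ℚ) (K : Type) [Field K] [NumberField K],
      kolyvagin N W K) ∧
    rank_eq_analyticRank_of_analyticRank_le_one ∧ HoffsteinLuo1997_exists_twist_L_one_ne_zero ∧
    mazur_not_dvd_maninConstant_of_odd ∧ bsdRHS_eq_of_isIsogenous) ∧
    thm210_thm211_bdpDisplay_pNew) ∧
    LiuZhangZhang2018.thm151_thm153_modularCurve_heegnerVector) ∧
    (prop125_characterGrSelmerDual_torsion_muZero_dim ∧
      cor126_residualCharacter_globalLift ∧ cor126_residualCharacter_localSurjective ∧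
      thm212_exists_isKatzLFunction ∧
      Literature.NumberTheory.EllipticCurves.Castella2018.cas20_thm211_memberForms_sigmaFrames_congr)) ∧
      Literature.NumberTheory.EllipticCurves.BCGKPST2020.thm331_rubin_exists_katzMeasure₂_pseudoIso_span_eq ∧
      Literature.NumberTheory.EllipticCurves.DeShalit1987.thmII64_katzMeasure₂_functionalEquation ∧
      Literature.NumberTheory.EllipticCurves.Hida2010MuInvariant.thmI_mu_katzBranch_reflect_eq_zero)
    (hPre :
    Literature.NumberTheory.EllipticCurves.KellerYin2024.thm308_imc2_hidaMember_dvd_OPEN ∧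
      Literature.NumberTheory.EllipticCurves.KellerYin2024.thm222_anacong_hidaMember_sigma_mu_OPEN ∧
      Literature.NumberTheory.EllipticCurves.KellerYin2024.thm222_anacong_hidaMember_sigma_lambda_OPEN ∧
      Literature.NumberTheory.EllipticCurves.KellerYin2024.thm308_imc2_hidaMember_isTorsion_OPEN)
    (hGal : Literature.NumberTheory.EllipticCurves.hida1986_castella2020_exists_frobeniusGaloisLattice_on_pNewBranchChart)
    (hMazur :
    Summit.BirchSwinnertonDyer.BirchSwinnertonDyer.Theses.EisensteinPrimes.MazurMCOnCellB) :
    Summit.BirchSwinnertonDyer.BirchSwinnertonDyer.Theses.EisensteinPrimes.BSDpOnCellC :=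
  EisensteinPrimesBSDpOnCellCOfCitedFactsV18.bsdpOnCellC_of_citedFactsH hPub hPre
    (Summit.BirchSwinnertonDyer.BirchSwinnertonDyer.Theorems.TelescopeBranchUntwistedOfFrobenius.untwistedGaloisLattice_of_frobeniusGaloisLattice hGal) hMazur

end Summit.BirchSwinnertonDyer.BirchSwinnertonDyer.Theorems.EisensteinPrimesBSDpOnCellCOfCitedFactsV19

end
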